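import Summits.HodgeConjecture.HodgeConjecture.Theorems.F0LD2ThetaTensorClasses
import Literature.NumberTheory.Automorphic.Liu2021.ThetaLiftFromLineContinuity
import HarnessLib

-- As in the lineage (★ `F0LD1ThetaTransportKit`, ★ `F0LD2ThetaTensorClasses`): statements over the theta-kernel datum
-- elaborate to very large types; elaborate sequentially.
set_option Elab.async false

/-!
# Crux `HLiu418`, line LD2 (organ C₂away `ArchTypeAway₂`) — KERNEL KIT «BRICK T3»: the class `Φ_∞ ↦ [Θ̃_{E(Φ_∞ ⊗ Φ_f)}(f) ∘ ιA]` is a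
# CONTINUOUS LINEAR MAP of the archimedean Schwartz function, along an ABSTRACT adelic transport `ιA` (★ `Liu2021.ThetaLiftFromLineContinuity` §1–§2 twins)

Cell hodgecm-mathlib (D-0151), FLOOR 0; crux item `HLiu418` = stmt-HodgeConjecture-24832 (route `HCCMUnconditional`); half-A line LD2
(`stub_S1b_facts` = #74 `Rogawski1990.curveThetaHodgeTypeNecessity_hol` of socket 27458 `Cruxes/HLiu418/Lines/F0_AlbCm.lean`), organ C₂away
`ArchTypeAway₂` of the LD2 skeleton (LD2-plan (g0), ED. 5 :358–:396; payer LA1-p01 (g2)).  THEOREMS ONLY (no `def`, no instance, no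
notation, no named fact, no `sorry`); `--supports stmt-HodgeConjecture-24832`.  HC_CM is proved only modulo the 7 printed citations
(2 remaining: hLiu418 = stmt-HodgeConjecture-24832, h413 = stmt-HodgeConjecture-24833) until rung 0 closes; this file discharges nothing
printed — kernel glue continuing ★ `F0LD1ThetaTransportKit` (LD1-p01 (g0)) and ★ `F0LD2ThetaTensorClasses` (LD2-p02 (g0)).

WHY.  Organ C₂away is the `n = 2` twin of the letter ★ `Liu2021.meetsThetaLiftFromLine_hol_archTypeAway`, whose `n = 3` closer
(★ `F0P2oCcArchTypeAwayHolds` over ★ `F0P2oCcThetaFunctionalCovariance`) reads the theta lift of the line along the LITERAL frame transport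
★ `cmAdelicFrameTransport L N H dV g hg` of an UNSCALED frame and the holomorphy through the BALL model (`cmCompactFactor`,
`IsHolCotangentAt`).  The LD organs carry an abstract `ιA` pinned by `↑(ιA k) = g_𝔸⁻¹ · k · g_𝔸` under the SCALED frame
`formCongr c g (t • H) = diagonal dV` and the CONE model (★ `UnitaryCurveForms.holCotForms₂`, `IsHolCotangentAt₂`).  Of the transport-dependent
inputs of the Cc road, the linearity in `Φ` and the pure-tensor reduction are ★ `F0LD2ThetaTensorClasses` (LD2-p02 (g0)); THIS file is BRICK T3
(abstract `ιA` with `hιA : Continuous ιA ∧ (rational ↦ rational)`, rank-generic `N`; the ★ proofs with `cmAdelicFrameTransport ↦ ιA`):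
`exists_clm_toLp_lineThetaLift_of_slot` (Weil's Théorème 6 in `Φ` along a linear family from a barrelled space, ★
`continuous_thetaLift_lineThetaKernelDatum_of_slot`, then precomposition with the continuous map `[x] ↦ [ιA x]` of compact quotients and Mathlib's
bounded `ContinuousMap.toLp`), `exists_clm_toLp_lineThetaLift_tmul` (`E = 𝓢((L⁺ ⊗ ℝ)^{n′})`, barrelled ★ `barrelledSpace_schwartzMap`; slots LF-continuous
★ `adelicMpCont.isLFContinuous_omega`), `exists_clm_comp_toLp_lineThetaLift_tmul` (composition with a continuous linear `S`, e.g. `pr_P`).  The sequel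
`Theorems/F0LD2ThetaKcInvariance` carries the rank-2 cone-model invariance under `ιA(K_c(w₁)) × 1` and the one-definite-place element through the
PINNED transport.

## References
* [Liu2021] Y. Liu, *Fourier–Jacobi cycles and arithmetic relative trace formula*, Camb. J. Math. 9 (2021) = arXiv:2102.11518: proof of
  Prop. 4.13 Case 1 (l. 2137–2141, p. 48); App. D Lem. D.2 (1) (p. 127, l. 5283).
* [Weil1964] A. Weil, *Sur certains groupes d'opérateurs unitaires*, Acta Math. 111 (1964), Chap. I n° 11, Chap. III n° 41 Thm 6 (p. 193).
* [BorelJacquet1979] A. Borel, H. Jacquet, PSPM 33.1 (1979), §4.1, §4.2, §4.6.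
* [Rudin1991] W. Rudin, *Functional Analysis*, 2nd ed. (1991), Thm 2.6 (Banach–Steinhaus).
* [TateThesis1967] J. Tate, in Cassels–Fröhlich (1967), §3.2, §4.2 (Schwartz–Bruhat functions as spans of pure tensors).
* [PlatonovRapinchuk1994] V. Platonov, A. Rapinchuk, *Algebraic Groups and Number Theory* (1994), §2.3, §5.1.
-/

set_option autoImplicit false
-- the mandated namespace has the single-problem summit's repeated segment (`HodgeConjecture.HodgeConjecture`)
set_option linter.dupNamespace false

noncomputable section

open NumberField NumberField.InfinitePlace NumberField.mixedEmbedding MeasureTheory IsDedekindDomain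
open scoped Matrix Kronecker ComplexOrder ENNReal TensorProduct SchwartzMap Classical
open Literature.NumberTheory.Automorphic Literature.NumberTheory.Automorphic.UnitaryGroup
open Literature.NumberTheory.Automorphic.UnitaryGroup.CotangentForms
open Literature.NumberTheory.Automorphic.IdeleClassGroup
open Literature.NumberTheory.Automorphic.Liu2021
open Literature.NumberTheory.Automorphic.Liu2021.Def411WeilCarriers
open Literature.NumberTheory.Automorphic.Liu2021.Def411WeilCarriersDoubling
open Literature.NumberTheory.GelbartRogawski1991 Literature.NumberTheory.GelbartRogawski1991.UnitaryDualPair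
open Literature.NumberTheory.Weil1964
open Literature.RepresentationTheory.Liu2021
open Literature.RepresentationTheory.CompactGroups
open Literature.RepresentationTheory.HeisenbergGroup

namespace Summit.HodgeConjecture.HodgeConjecture.Cruxes.HLiu418.F0LD2ThetaTensorCLM

/-! ## §1 Brick T3 along an ABSTRACT transport: `Φ_∞ ↦ [Θ̃_{E(Φ_∞ ⊗ Φ_f)}(f) ∘ ιA]` is a continuous linear map -/

section Lift

variable (L : Type) [Field L] [NumberField L] [IsCMField L] (N : ℕ) (H : Matrix (Fin N) (Fin N) L)
  {n' : ℕ} (e₁ : Fin N × Fin 1 ≃ Fin n') (dV : Fin N → L) (hdV : ∀ i, IsCMField.complexConj L (dV i) = dV i)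
  (hdV0 : ∀ i, dV i ≠ 0)
  (ιA : (adelicGroupData (↥(maximalRealSubfield L)) L (IsCMField.complexConj L) N H).Adelic →* ↥(UnitaryGroup.adelic (↥(maximalRealSubfield L)) L (IsCMField.complexConj L) N (Matrix.diagonal dV)))
  (hιA : Continuous ιA ∧ ∀ ⦃γ : (adelicGroupData (↥(maximalRealSubfield L)) L (IsCMField.complexConj L) N H).Adelic⦄,
    γ ∈ (UnitaryGroup.toAdelic (↥(maximalRealSubfield L)) L (IsCMField.complexConj L) N H).range →
      ιA γ ∈ (UnitaryGroup.toAdelic (↥(maximalRealSubfield L)) L (IsCMField.complexConj L) N (Matrix.diagonal dV)).range)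
  (μ : Literature.NumberTheory.Automorphic.IdeleClassGroup L →ₜ* Circle) (hμ : IsConjugateSymplectic L μ) (a : (↥(maximalRealSubfield L))ˣ)
  (hρ : HasThetaMajorants fun
      (p : ↥(UnitaryGroup.adelic (↥(maximalRealSubfield L)) L (IsCMField.complexConj L) N (Matrix.diagonal dV)) × ↥(UnitaryGroup.adelic (↥(maximalRealSubfield L)) L (IsCMField.complexConj L) 1 (JW (↥(maximalRealSubfield L)) L a))) (Φ : piSchwartzBruhat (↥(maximalRealSubfield L)) (Fin n')) =>
        pairRep (↥(maximalRealSubfield L)) L (IsCMField.complexConj L) N 1 e₁ (Matrix.diagonal dV) (JW (↥(maximalRealSubfield L)) L a)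
          (chiSplittingLine L e₁ dV hdV hdV0 (toHeckeCharacter L μ) (isUnitary_toHeckeCharacter L μ)
            ((isOscillatorChar_toHeckeCharacter_iff μ).mpr hμ) (TW (↥(maximalRealSubfield L)) a)
            (isUnit_det_TW (↥(maximalRealSubfield L)) a) (JW (↥(maximalRealSubfield L)) L a) (JW_eq (↥(maximalRealSubfield L)) L a))
          p Φ)
  [CompactSpace (↥(UnitaryGroup.adelic (↥(maximalRealSubfield L)) L (IsCMField.complexConj L) N (Matrix.diagonal dV)) ⧸ (UnitaryGroup.toAdelic (↥(maximalRealSubfield L)) L (IsCMField.complexConj L) N (Matrix.diagonal dV)).range)] [MeasurableSpace (↥(UnitaryGroup.adelic (↥(maximalRealSubfield L)) L (IsCMField.complexConj L) 1 (JW (↥(maximalRealSubfield L)) L a)) ⧸ (UnitaryGroup.toAdelic (↥(maximalRealSubfield L)) L (IsCMField.complexConj L) 1 (JW (↥(maximalRealSubfield L)) L a)).range)] (μW : Measure (↥(UnitaryGroup.adelic (↥(maximalRealSubfield L)) L (IsCMField.complexConj L) 1 (JW (↥(maximalRealSubfield L)) L a)) ⧸ (UnitaryGroup.toAdelic (↥(maximalRealSubfield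 L)) L (IsCMField.complexConj L) 1 (JW (↥(maximalRealSubfield L)) L a)).range))
  (f : C((↥(UnitaryGroup.adelic (↥(maximalRealSubfield L)) L (IsCMField.complexConj L) 1 (JW (↥(maximalRealSubfield L)) L a)) ⧸ (UnitaryGroup.toAdelic (↥(maximalRealSubfield L)) L (IsCMField.complexConj L) 1 (JW (↥(maximalRealSubfield L)) L a)).range), ℂ))

include hιA

variable [BorelSpace (↥(UnitaryGroup.adelic (↥(maximalRealSubfield L)) L (IsCMField.complexConj L) 1 (JW (↥(maximalRealSubfield L)) L a)) ⧸ (UnitaryGroup.toAdelic (↥(maximalRealSubfield L)) L (IsCMField.complexConj L) 1 (JW (↥(maximalRealSubfield L)) L a)).range)] [IsFiniteMeasure μW]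
  [CompactSpace (adelicGroupData (↥(maximalRealSubfield L)) L (IsCMField.complexConj L) N H).automorphicQuotient]
  (ν : Measure (adelicGroupData (↥(maximalRealSubfield L)) L (IsCMField.complexConj L) N H).automorphicQuotient) [IsFiniteMeasure ν]

/-- **THE `L²`-CLASS ALONG A LINEAR FAMILY IS A CONTINUOUS LINEAR MAP** (abstract transport).  For a `ℂ`-linear `Λ : E → 𝒮(𝔸_{L⁺}^{n′})`
from a barrelled space with continuous slots `e ↦ Θ(ω(s_pair p)(Λ e))`, there is a continuous linear `T : E →L[ℂ] L²([U(H)], ν)` with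
`T e = [Θ̃_{Λ e}(f) ∘ ιA]` for every `e` — the ★ proof of `Liu2021.exists_clm_toLp_lineThetaLift_of_slot` with `cmAdelicFrameTransport ↦ ιA`
(linearity §1; continuity ★ `continuous_thetaLift_lineThetaKernelDatum_of_slot`, then precomposition with the continuous map `[x] ↦ [ιA x]` of
compact quotients and Mathlib's bounded `ContinuousMap.toLp`). [cite: Weil1964, Chap. III n° 41, Thm 6 p. 193] [cite: Rudin1991, Thm 2.6]
[cite: BorelJacquet1979, §4.2, §4.6] -/
theorem exists_clm_toLp_lineThetaLift_of_slot
    {E : Type*} [AddCommGroup E] [Module ℂ E] [UniformSpace E] [IsUniformAddGroup E] [ContinuousSMul ℂ E] [BarrelledSpace ℂ E]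
    (Λ : E →ₗ[ℂ] piSchwartzBruhat (↥(maximalRealSubfield L)) (Fin n'))
    (hΛ : ∀ p : ↥(UnitaryGroup.adelic (↥(maximalRealSubfield L)) L (IsCMField.complexConj L) N (Matrix.diagonal dV)) × ↥(UnitaryGroup.adelic (↥(maximalRealSubfield L)) L (IsCMField.complexConj L) 1 (JW (↥(maximalRealSubfield L)) L a)),
      Continuous fun e => thetaDistLM (↥(maximalRealSubfield L)) (Fin n')
        (pairRep (↥(maximalRealSubfield L)) L (IsCMField.complexConj L) N 1 e₁ (Matrix.diagonal dV) (JW (↥(maximalRealSubfield L)) L a)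
          (chiSplittingLine L e₁ dV hdV hdV0 (toHeckeCharacter L μ) (isUnitary_toHeckeCharacter L μ)
            ((isOscillatorChar_toHeckeCharacter_iff μ).mpr hμ) (TW (↥(maximalRealSubfield L)) a)
            (isUnit_det_TW (↥(maximalRealSubfield L)) a) (JW (↥(maximalRealSubfield L)) L a) (JW_eq (↥(maximalRealSubfield L)) L a))
          p (Λ e))) :
    ∃ T : E →L[ℂ] Lp ℂ 2 ν, ∀ e,
      T e = MemLp.toLp _ (F0LD1ThetaTransportKit.memLp_toQuotFun_lineThetaLift L N H e₁ dV hdV hdV0 ιA hιA μ hμ a hρ μW (Λ e) f ν 2) := by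
  haveI := compactSpace_quotient_range_toAdelic_JW L a
  -- the transport of the quotients `[U(H)] → [U(diag dV)]`, `[x] ↦ [ιA x]`, as a continuous map
  have hwd : ∀ x y : (adelicGroupData (↥(maximalRealSubfield L)) L (IsCMField.complexConj L) N H).Adelic,
      QuotientGroup.leftRel (adelicGroupData (↥(maximalRealSubfield L)) L (IsCMField.complexConj L) N H).quotientSubgroup x y →
        (QuotientGroup.mk (ιA x) :
            ↥(UnitaryGroup.adelic (↥(maximalRealSubfield L)) L (IsCMField.complexConj L) N (Matrix.diagonal dV)) ⧸
              (UnitaryGroup.toAdelic (↥(maximalRealSubfield L)) L (IsCMField.complexConj L) N (Matrix.diagonal dV)).range) =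
          QuotientGroup.mk (ιA y) := by
    intro x y hxy
    rw [QuotientGroup.leftRel_apply] at hxy
    have h' : x⁻¹ * y ∈ (⊥ : Subgroup (adelicGroupData (↥(maximalRealSubfield L)) L (IsCMField.complexConj L) N H).Adelic) ⊔
        (UnitaryGroup.toAdelic (↥(maximalRealSubfield L)) L (IsCMField.complexConj L) N H).range := hxy
    rw [bot_sup_eq] at h'
    refine QuotientGroup.eq.mpr ?_
    rw [← map_inv, ← map_mul]
    exact hιA.2 h'
  let qmap : C((adelicGroupData (↥(maximalRealSubfield L)) L (IsCMField.complexConj L) N H).automorphicQuotient,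
      ↥(UnitaryGroup.adelic (↥(maximalRealSubfield L)) L (IsCMField.complexConj L) N (Matrix.diagonal dV)) ⧸
        (UnitaryGroup.toAdelic (↥(maximalRealSubfield L)) L (IsCMField.complexConj L) N (Matrix.diagonal dV)).range) :=
    ⟨fun q => Quotient.liftOn' q (fun x => (QuotientGroup.mk (ιA x) :
        ↥(UnitaryGroup.adelic (↥(maximalRealSubfield L)) L (IsCMField.complexConj L) N (Matrix.diagonal dV)) ⧸
          (UnitaryGroup.toAdelic (↥(maximalRealSubfield L)) L (IsCMField.complexConj L) N (Matrix.diagonal dV)).range)) hwd,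
      (continuous_quotient_mk'.comp hιA.1).quotient_liftOn' hwd⟩
  -- `e ↦ toQuotFun (Θ̃_{Λ e}(f) ∘ ιA)` as a linear map `E → C([U(H)], ℂ)`
  let Tq : E →ₗ[ℂ] C((adelicGroupData (↥(maximalRealSubfield L)) L (IsCMField.complexConj L) N H).automorphicQuotient, ℂ) :=
    { toFun := fun e => ⟨toQuotFun (adelicGroupData (↥(maximalRealSubfield L)) L (IsCMField.complexConj L) N H) fun y =>
          (lineThetaKernelDatum L N e₁ dV hdV hdV0 μ hμ a hρ).thetaLiftFun μW (Λ e) f (ιA y),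
        F0LD1ThetaTransportKit.continuous_toQuotFun_lineThetaLift L N H e₁ dV hdV hdV0 ιA hιA μ hμ a hρ μW (Λ e) f⟩
      map_add' := fun x y => ContinuousMap.ext fun q => by
        simpa [map_add] using
          congrFun (F0LD2ThetaTensorClasses.toQuotFun_lineThetaLift_add_left L N H e₁ dV hdV hdV0 ιA hιA μ hμ a hρ μW f (Λ x) (Λ y)) q
      map_smul' := fun r x => ContinuousMap.ext fun q => by
        simpa [map_smul] using
          congrFun (F0LD2ThetaTensorClasses.toQuotFun_lineThetaLift_smul_left L N H e₁ dV hdV hdV0 ιA hιA μ hμ a hρ μW f r (Λ x)) q }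
  -- it is `e ↦ Θ_{Λ e}(f) ∘ qmap`, hence continuous
  have hTq_eq : ∀ e, Tq e = ((lineThetaKernelDatum L N e₁ dV hdV hdV0 μ hμ a hρ).thetaLift μW (Λ e) f).comp qmap := fun e => by
    refine ContinuousMap.ext fun q => ?_
    obtain ⟨x, rfl⟩ := QuotientGroup.mk_surjective q
    show toQuotFun (adelicGroupData (↥(maximalRealSubfield L)) L (IsCMField.complexConj L) N H) (fun y =>
        (lineThetaKernelDatum L N e₁ dV hdV hdV0 μ hμ a hρ).thetaLiftFun μW (Λ e) f (ιA y))
          ((adelicGroupData (↥(maximalRealSubfield L)) L (IsCMField.complexConj L) N H).toAutomorphicQuotient x) =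
      (lineThetaKernelDatum L N e₁ dV hdV hdV0 μ hμ a hρ).thetaLift μW (Λ e) f (QuotientGroup.mk (ιA x))
    exact F0LD1ThetaTransportKit.toQuotFun_lineThetaLift_mk L N H e₁ dV hdV hdV0 ιA hιA μ hμ a hρ μW (Λ e) f x
  have hTq_cont : Continuous Tq := by
    have h : Continuous fun e => ((lineThetaKernelDatum L N e₁ dV hdV hdV0 μ hμ a hρ).thetaLift μW (Λ e) f).comp qmap :=
      (ContinuousMap.continuous_precomp qmap).comp
        (continuous_thetaLift_lineThetaKernelDatum_of_slot L N e₁ dV hdV hdV0 μ hμ a hρ μW f Λ hΛ)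
    exact h.congr fun e => (hTq_eq e).symm
  refine ⟨(ContinuousMap.toLp 2 ν ℂ).comp ⟨Tq, hTq_cont⟩, fun e => ?_⟩
  show ContinuousMap.toLp (E := ℂ) 2 ν ℂ (Tq e) = _
  rfl

/-- **BRICK T3 along an abstract transport: `Φ_∞ ↦ [Θ̃_{E(Φ_∞ ⊗ Φ_f)}(f) ∘ ιA]` is a continuous linear map
`𝓢((L⁺ ⊗ ℝ)^{n′}) → L²([U(H)], ν)`** for every finite test function `Φ_f` (`E = piSchwartzBruhatEquiv`; every `ω(s_pair p)` is LF-continuous,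
★ `adelicMpCont.isLFContinuous_omega`, and `𝓢(X_∞)` is barrelled, ★ `barrelledSpace_schwartzMap`) — the ★ proof of
`Liu2021.exists_clm_toLp_lineThetaLift_tmul` with `cmAdelicFrameTransport ↦ ιA`. [cite: Weil1964, Chap. I n° 11 pp. 157–158; Chap. III n° 41, Thm 6 p. 193]
[cite: Rudin1991, Thm 2.6] -/
theorem exists_clm_toLp_lineThetaLift_tmul (Φf : FinSB (↥(maximalRealSubfield L)) (Fin n')) :
    ∃ T : 𝓢((Fin n' → mixedEmbedding.mixedSpace ↥(maximalRealSubfield L)), ℂ) →L[ℂ] Lp ℂ 2 ν, ∀ φ,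
      T φ = MemLp.toLp _ (F0LD1ThetaTransportKit.memLp_toQuotFun_lineThetaLift L N H e₁ dV hdV hdV0 ιA hιA μ hμ a hρ μW
        (piSchwartzBruhatEquiv (↥(maximalRealSubfield L)) (Fin n') (φ ⊗ₜ[ℂ] Φf)) f ν 2) := by
  haveI : BarrelledSpace ℂ 𝓢((Fin n' → mixedEmbedding.mixedSpace ↥(maximalRealSubfield L)), ℂ) :=
    Literature.Analysis.FunctionSpaces.barrelledSpace_schwartzMap
  exact exists_clm_toLp_lineThetaLift_of_slot L N H e₁ dV hdV hdV0 ιA hιA μ hμ a hρ μW f ν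
    ((piSchwartzBruhatEquiv (↥(maximalRealSubfield L)) (Fin n')).toLinearMap ∘ₗ
      (TensorProduct.mk ℂ 𝓢((Fin n' → mixedEmbedding.mixedSpace ↥(maximalRealSubfield L)), ℂ)
        (FinSB (↥(maximalRealSubfield L)) (Fin n'))).flip Φf)
    fun p => continuous_thetaDistLM_comp_tmul_of_isLFContinuous (adelicMpCont.isLFContinuous_omega _) Φf

/-- **`Φ_∞ ↦ S [Θ̃_{E(Φ_∞ ⊗ Φ_f)}(f) ∘ ιA]` is a continuous linear map** for every continuous linear `S` out of `L²([U(H)], ν)` (abstract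
transport) — at `S := pr_P` this is brick T3 of the Cc road (★ `Liu2021.exists_clm_comp_toLp_lineThetaLift_tmul` with `cmAdelicFrameTransport ↦ ιA`).
[cite: Weil1964, Chap. III n° 41, Thm 6 p. 193] [cite: Rudin1991, Thm 2.6] [cite: Liu2021, proof of Prop. 4.13 Case 1 (l. 2137–2141, p. 48); App. D Lem. D.2 (1)] -/
theorem exists_clm_comp_toLp_lineThetaLift_tmul {X : Type*} [NormedAddCommGroup X] [NormedSpace ℂ X] (S : Lp ℂ 2 ν →L[ℂ] X)
    (Φf : FinSB (↥(maximalRealSubfield L)) (Fin n')) :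
    ∃ T : 𝓢((Fin n' → mixedEmbedding.mixedSpace ↥(maximalRealSubfield L)), ℂ) →L[ℂ] X, ∀ φ,
      T φ = S (MemLp.toLp _ (F0LD1ThetaTransportKit.memLp_toQuotFun_lineThetaLift L N H e₁ dV hdV hdV0 ιA hιA μ hμ a hρ μW
        (piSchwartzBruhatEquiv (↥(maximalRealSubfield L)) (Fin n') (φ ⊗ₜ[ℂ] Φf)) f ν 2)) := by
  obtain ⟨T, hT⟩ := exists_clm_toLp_lineThetaLift_tmul L N H e₁ dV hdV hdV0 ιA hιA μ hμ a hρ μW f ν Φf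
  exact ⟨S.comp T, fun φ => by rw [ContinuousLinearMap.comp_apply, hT]⟩

end Lift

end Summit.HodgeConjecture.HodgeConjecture.Cruxes.HLiu418.F0LD2ThetaTensorCLM

end
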